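import Mathlib
import HarnessLib

/-!
# QUANT lane R8, front "FAR beyond trees", layer one — CYC-DEC at the law level, file 1: DEFINITIONS
# (the two-reversed-chain system with hub loads, its block numbers, and the per-position data of the left arm)

builds on p205010 (kernel theorem, internal audit signed; external expert review pending)

Support file (`--supports stmt-CriticalPhenomena-4575`), seat `prim-quant-p1` (gen 21); memo
`run/shared/lean/prim/quant/prim-quant-p1-g21/FOR-LEAD-CYCDEC.md` §1, §3, §6.  Definitions only (plus their unfolding lemmas and
the stability of validity under removing the first hub); standard axioms; no sorries.

THE MODEL (memo §1).  Hubs `1, 2, …, n` in a row.  The LEFT arm covers the prefix `[1..L]` with `P(L ≥ i) = A i`, the RIGHT arm covers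
the suffix `[ρ..n]` with `P(ρ ≤ j) = B j`, independently (`A` antitone, `B` monotone, `B j = 1` for `j > n`); hub `i` carries an independent
count `W_i ∈ {0, 1, ≥ 2}` with law `(z i, s i, d i)`.  This is the law of the set of loaded vertices joined to the cut vertex of a pendant
CYCLE (`A i = a_0⋯a_{i−1}`, `B j = a_n⋯a_j`), and more generally of any two REVERSED independent chains (p1 g20 memo §5).  The data are a
`TwoChain` (five functions `ℕ → ℝ`; values at indices `> n` other than `B = 1` are irrelevant); `TwoChain.shift` removes hub `1` (the
system of hubs `2, …, n`, re-indexed), which is again a two-reversed-chain system — the induction of the k-anchor programme runs on it.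

THE NUMBERS are defined by explicit finite recursions / sums whose probabilistic meaning is (memo §3, §6; `f` = number of FREE hubs before
the right arm, i.e. the right arm covers `[f+1..n]`, which happens with probability `w f = B (f+1) − B f` for `1 ≤ f ≤ n`, and `f = 0`
(everything covered) with probability `B 1`):
* `ZF f C = P(no unit among hubs 1..f)`, `SF f C = P(exactly one unit among hubs 1..f)`;
* `g1 f C = P(the left arm collects ≥ 1 unit among hubs 1..f)`, `g2 f C = P(… ≥ 2 units …)`;
* `ZQ n f C = P(no unit among hubs f+1..n)`, `SQ n f C = P(exactly one unit among hubs f+1..n)`;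
* aggregates over the position of the right arm: `PE = Σ_f w·ZQ`, `PS = Σ_f w·SQ`, `DN = Σ_f w·ZQ·g1`, `GZ = Σ_f w·ZQ·g2`, `GS = Σ_f w·SQ·g1`;
* `omH n C = P(X = 0) = B1·ZF n + PE − DN` and `TT n C = P(X ≥ 2) = B1·(1 − ZF n − SF n) + GZ + GS + (1 − B1) − PE − PS`, where `X` is the
  number of units delivered to the cut vertex; the block numbers are `hh = 1 − omH = P(X ≥ 1)` and `tt = TT`;
* `hProd`, `tProd`: the numbers of the fully DECOUPLED block (independent stems `Bern(m i)`, `m i = A i ⊕ B i`), by the independent-sum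
  recursion `h ↦ m₁u₁ + (1 − m₁u₁)h`, `t ↦ m₁d₁ + m₁s₁h + (1 − m₁u₁)t` (the `dominates_noise` map of `T/…QuantFarDecChain`).
That these recursions compute the said probabilities is elementary bookkeeping (conditioning on the position of the right arm, then on the
first hub); it was checked against brute-force enumeration of the law in exact arithmetic (memo §7, `num/rec_defs.py`), and it is the form in
which the graph-level transfer (memo §6(5)) will consume the theorem.  Files 2–4 (`…LawBounds`, `…LawStep`, `…LawCycDec`) prove the k-anchor
inequality CYC-DEC for every `n` from these definitions and the abstract files `T/…QuantFarDecStep`, `T/…QuantFarDecRatio(Pair)`.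
[this work]
-/

namespace Summit.CriticalPhenomena.PercolationContinuityZ3.Theorems

namespace Quant

namespace Block

open Finset

/-- Data of a two-reversed-chain system with hub loads: `A i = P(left arm reaches hub i)`, `B j = P(right arm reaches hub j)`,
`(z i, s i, d i)` = law of hub `i`'s count on `{0, 1, ≥ 2}` (hubs are `1, 2, …`; index `0` and indices beyond the number of hubs are unused,
except that validity asks `B = 1` there). [this work] -/
structure TwoChain where
  /-- `P(left arm reaches hub i)` (antitone) -/
  A : ℕ → ℝ
  /-- `P(right arm reaches hub j)` (monotone, `= 1` beyond the last hub) -/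
  B : ℕ → ℝ
  /-- `P(W_i = 0)` -/
  z : ℕ → ℝ
  /-- `P(W_i = 1)` -/
  s : ℕ → ℝ
  /-- `P(W_i ≥ 2)` -/
  d : ℕ → ℝ

namespace TwoChain

/-- `u i = P(W_i ≥ 1) = s i + d i`. [this work] -/
def u (C : TwoChain) (i : ℕ) : ℝ := C.s i + C.d i

/-- the marginal `m i = P(hub i is reached) = A i + B i − A i·B i`. [this work] -/
def m (C : TwoChain) (i : ℕ) : ℝ := C.A i + C.B i - C.A i * C.B i

/-- Removing hub `1`: the system of hubs `2, 3, …`, re-indexed from `1` (again two reversed chains). [this work] -/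
def shift (C : TwoChain) : TwoChain :=
  ⟨fun i => C.A (i + 1), fun i => C.B (i + 1), fun i => C.z (i + 1), fun i => C.s (i + 1), fun i => C.d (i + 1)⟩

/-- Validity of the data for `n` hubs: probabilities in `[0,1]`, `A` antitone, `B` monotone and `= 1` beyond hub `n`, hub laws normalised.
(Stated for all indices; the values at unused indices can always be chosen this way.) [this work] -/
structure Valid (C : TwoChain) (n : ℕ) : Prop where
  A_nonneg : ∀ i, 0 ≤ C.A i
  A_le_one : ∀ i, C.A i ≤ 1
  A_anti : ∀ i, C.A (i + 1) ≤ C.A i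
  B_nonneg : ∀ i, 0 ≤ C.B i
  B_le_one : ∀ i, C.B i ≤ 1
  B_mono : ∀ i, C.B i ≤ C.B (i + 1)
  B_top : ∀ j, n + 1 ≤ j → C.B j = 1
  z_nonneg : ∀ i, 0 ≤ C.z i
  s_nonneg : ∀ i, 0 ≤ C.s i
  d_nonneg : ∀ i, 0 ≤ C.d i
  zsd : ∀ i, C.z i + C.s i + C.d i = 1

/-- `P(no unit among the first f hubs)`. [this work] -/
def ZF : ℕ → TwoChain → ℝ
  | 0, _ => 1
  | f + 1, C => C.z 1 * ZF f C.shift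

/-- `P(exactly one unit among the first f hubs)`. [this work] -/
def SF : ℕ → TwoChain → ℝ
  | 0, _ => 0
  | f + 1, C => C.s 1 * ZF f C.shift + C.z 1 * SF f C.shift

/-- `P(the left arm collects at least one unit among the first f hubs)`. [this work] -/
def g1 : ℕ → TwoChain → ℝ
  | 0, _ => 0
  | f + 1, C => C.A 1 * C.u 1 + C.z 1 * g1 f C.shift

/-- `P(the left arm collects at least two units among the first f hubs)`. [this work] -/
def g2 : ℕ → TwoChain → ℝ
  | 0, _ => 0
  | f + 1, C => C.A 1 * C.d 1 + C.s 1 * g1 f C.shift + C.z 1 * g2 f C.shift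

/-- `P(no unit among hubs f+1, …, n)` (the hubs covered by the right arm when `f` hubs are free). [this work] -/
def ZQ : ℕ → ℕ → TwoChain → ℝ
  | n, 0, C => ZF n C
  | 0, _ + 1, _ => 1
  | n + 1, f + 1, C => ZQ n f C.shift

/-- `P(exactly one unit among hubs f+1, …, n)`. [this work] -/
def SQ : ℕ → ℕ → TwoChain → ℝ
  | n, 0, C => SF n C
  | 0, _ + 1, _ => 0
  | n + 1, f + 1, C => SQ n f C.shift

/-- `w f = P(the right arm covers exactly hubs f+1, …, n) = B (f+1) − B f` (`1 ≤ f ≤ n`; `B (n+1) = 1`). [this work] -/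
def w (C : TwoChain) (f : ℕ) : ℝ := C.B (f + 1) - C.B f

/-- `PE = Σ_{f=1}^{n} w f · ZQ n f` (`= P(some hub free and no unit under the right arm)`). [this work] -/
def PE (n : ℕ) (C : TwoChain) : ℝ := ∑ f ∈ range n, C.w (f + 1) * ZQ n (f + 1) C

/-- `PS = Σ_{f=1}^{n} w f · SQ n f`. [this work] -/
def PS (n : ℕ) (C : TwoChain) : ℝ := ∑ f ∈ range n, C.w (f + 1) * SQ n (f + 1) C

/-- `DN = Σ_{f=1}^{n} w f · ZQ n f · g1 f` (`= P(no unit under the right arm, the left arm collects ≥ 1) = E U(R) − E U(Q)`). [this work] -/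
def DN (n : ℕ) (C : TwoChain) : ℝ := ∑ f ∈ range n, C.w (f + 1) * ZQ n (f + 1) C * g1 (f + 1) C

/-- `GZ = Σ_{f=1}^{n} w f · ZQ n f · g2 f`. [this work] -/
def GZ (n : ℕ) (C : TwoChain) : ℝ := ∑ f ∈ range n, C.w (f + 1) * ZQ n (f + 1) C * g2 (f + 1) C

/-- `GS = Σ_{f=1}^{n} w f · SQ n f · g1 f`. [this work] -/
def GS (n : ℕ) (C : TwoChain) : ℝ := ∑ f ∈ range n, C.w (f + 1) * SQ n (f + 1) C * g1 (f + 1) C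

/-- `omH n C = P(X = 0)` for the true block (`X` = units delivered to the cut vertex): `B1·ZF n + PE − DN`. [this work] -/
def omH (n : ℕ) (C : TwoChain) : ℝ := C.B 1 * ZF n C + PE n C - DN n C

/-- `TT n C = P(X ≥ 2)` for the true block: `B1·(1 − ZF n − SF n) + GZ + GS + (1 − B1) − PE − PS`. [this work] -/
def TT (n : ℕ) (C : TwoChain) : ℝ := C.B 1 * (1 - ZF n C - SF n C) + GZ n C + GS n C + (1 - C.B 1) - PE n C - PS n C

/-- `hh n C = P(X ≥ 1)` for the true block. [this work] -/
def hh (n : ℕ) (C : TwoChain) : ℝ := 1 - omH n C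

/-- `tt n C = P(X ≥ 2)` for the true block. [this work] -/
def tt (n : ℕ) (C : TwoChain) : ℝ := TT n C

/-- `P(X^⊥ ≥ 1)` for the fully DECOUPLED block (independent stems `Bern(m i)`): independent-sum recursion. [this work] -/
def hProd : ℕ → TwoChain → ℝ
  | 0, _ => 0
  | n + 1, C => C.m 1 * C.u 1 + (1 - C.m 1 * C.u 1) * hProd n C.shift

/-- `P(X^⊥ ≥ 2)` for the fully DECOUPLED block: independent-sum recursion (`t ↦ m₁d₁ + m₁s₁·h + (1 − m₁u₁)·t`). [this work] -/
def tProd : ℕ → TwoChain → ℝ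
  | 0, _ => 0
  | n + 1, C => C.m 1 * C.d 1 + C.m 1 * C.s 1 * hProd n C.shift + (1 - C.m 1 * C.u 1) * tProd n C.shift

section Unfold

variable (C : TwoChain) (n f : ℕ)

/-- unfolding lemma (`shift_A`). [this work] -/
@[simp] theorem shift_A (i : ℕ) : C.shift.A i = C.A (i + 1) := rfl
/-- unfolding lemma (`shift_B`). [this work] -/
@[simp] theorem shift_B (i : ℕ) : C.shift.B i = C.B (i + 1) := rfl
/-- unfolding lemma (`shift_z`). [this work] -/
@[simp] theorem shift_z (i : ℕ) : C.shift.z i = C.z (i + 1) := rfl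
/-- unfolding lemma (`shift_s`). [this work] -/
@[simp] theorem shift_s (i : ℕ) : C.shift.s i = C.s (i + 1) := rfl
/-- unfolding lemma (`shift_d`). [this work] -/
@[simp] theorem shift_d (i : ℕ) : C.shift.d i = C.d (i + 1) := rfl
/-- [this work] -/ theorem shift_u (i : ℕ) : C.shift.u i = C.u (i + 1) := rfl
/-- [this work] -/ theorem shift_m (i : ℕ) : C.shift.m i = C.m (i + 1) := rfl
/-- [this work] -/ theorem shift_w (i : ℕ) : C.shift.w i = C.w (i + 1) := rfl
/-- unfolding lemma (`ZF_zero`). [this work] -/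
@[simp] theorem ZF_zero : ZF 0 C = 1 := rfl
/-- unfolding lemma (`ZF_succ`). [this work] -/
@[simp] theorem ZF_succ : ZF (f + 1) C = C.z 1 * ZF f C.shift := rfl
/-- unfolding lemma (`SF_zero`). [this work] -/
@[simp] theorem SF_zero : SF 0 C = 0 := rfl
/-- unfolding lemma (`SF_succ`). [this work] -/
@[simp] theorem SF_succ : SF (f + 1) C = C.s 1 * ZF f C.shift + C.z 1 * SF f C.shift := rfl
/-- unfolding lemma (`g1_zero`). [this work] -/
@[simp] theorem g1_zero : g1 0 C = 0 := rfl
/-- unfolding lemma (`g1_succ`). [this work] -/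
@[simp] theorem g1_succ : g1 (f + 1) C = C.A 1 * C.u 1 + C.z 1 * g1 f C.shift := rfl
/-- unfolding lemma (`g2_zero`). [this work] -/
@[simp] theorem g2_zero : g2 0 C = 0 := rfl
/-- unfolding lemma (`g2_succ`). [this work] -/
@[simp] theorem g2_succ : g2 (f + 1) C = C.A 1 * C.d 1 + C.s 1 * g1 f C.shift + C.z 1 * g2 f C.shift := rfl
/-- unfolding lemma (`ZQ_zero_right`). [this work] -/
@[simp] theorem ZQ_zero_right : ZQ n 0 C = ZF n C := by cases n <;> rfl
/-- unfolding lemma (`ZQ_zero_succ`). [this work] -/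
@[simp] theorem ZQ_zero_succ : ZQ 0 (f + 1) C = 1 := rfl
/-- unfolding lemma (`ZQ_succ_succ`). [this work] -/
@[simp] theorem ZQ_succ_succ : ZQ (n + 1) (f + 1) C = ZQ n f C.shift := rfl
/-- unfolding lemma (`SQ_zero_right`). [this work] -/
@[simp] theorem SQ_zero_right : SQ n 0 C = SF n C := by cases n <;> rfl
/-- unfolding lemma (`SQ_zero_succ`). [this work] -/
@[simp] theorem SQ_zero_succ : SQ 0 (f + 1) C = 0 := rfl
/-- unfolding lemma (`SQ_succ_succ`). [this work] -/
@[simp] theorem SQ_succ_succ : SQ (n + 1) (f + 1) C = SQ n f C.shift := rfl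
/-- unfolding lemma (`hProd_zero`). [this work] -/
@[simp] theorem hProd_zero : hProd 0 C = 0 := rfl
/-- unfolding lemma (`hProd_succ`). [this work] -/
@[simp] theorem hProd_succ : hProd (n + 1) C = C.m 1 * C.u 1 + (1 - C.m 1 * C.u 1) * hProd n C.shift := rfl
/-- unfolding lemma (`tProd_zero`). [this work] -/
@[simp] theorem tProd_zero : tProd 0 C = 0 := rfl
/-- unfolding lemma (`tProd_succ`). [this work] -/
@[simp] theorem tProd_succ :
    tProd (n + 1) C = C.m 1 * C.d 1 + C.m 1 * C.s 1 * hProd n C.shift + (1 - C.m 1 * C.u 1) * tProd n C.shift := rfl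

end Unfold

/-- Validity passes to the system of hubs `2, …, n+1`. [this work] -/
theorem Valid.shift {C : TwoChain} {n : ℕ} (h : C.Valid (n + 1)) : C.shift.Valid n where
  A_nonneg i := h.A_nonneg (i + 1)
  A_le_one i := h.A_le_one (i + 1)
  A_anti i := h.A_anti (i + 1)
  B_nonneg i := h.B_nonneg (i + 1)
  B_le_one i := h.B_le_one (i + 1)
  B_mono i := h.B_mono (i + 1)
  B_top j hj := h.B_top (j + 1) (by omega)
  z_nonneg i := h.z_nonneg (i + 1)
  s_nonneg i := h.s_nonneg (i + 1)
  d_nonneg i := h.d_nonneg (i + 1)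
  zsd i := h.zsd (i + 1)

/-- Validity for `n + 1` hubs implies validity for `n` hubs of the SAME data only through `shift`; but weakening the hub count upward is
free in the other direction: `Valid C n → B (n+1) = 1`. [this work] -/
theorem Valid.B_succ {C : TwoChain} {n : ℕ} (h : C.Valid n) : C.B (n + 1) = 1 := h.B_top (n + 1) le_rfl

end TwoChain

end Block

end Quant

end Summit.CriticalPhenomena.PercolationContinuityZ3.Theorems
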